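import Summits.AtomisticToContinuum.Crystallization.Theorems.FrustratedLawDichotomyStrainedPatchWindowFamilies
import Summits.AtomisticToContinuum.Crystallization.Theorems.FrustratedLawDichotomyStrainedPatchTaylorRegular

/-!
# (T2ʷ) — the (T2-bent₁) split re-run over the window-honest comparison family `𝓘₁ʷ` (lens-5 g54, file SW; T-side of crux 27623)

`…WindowFamilies.TaylorTwoBentW := SmoothTaylorTwo CompFamilyW (7/20) (1/20) G₀ w₀ ϱ₀` is (T2-bent₁) with the comparison family `𝓘₁⁺ = CompFamily1`
replaced by `𝓘₁ʷ = CompFamilyW` (radius conjunct `133/10 ↦ 16`, NODE-g54 §10–§11: the RIM CRACK and fix W′).  The g53 proof of (T2-bent₁)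
(`…TaylorSplit` → `…TaylorPair` → `…TaylorLeaves`/`…TaylorRegular` → `…TaylorKband` → `…TaylorTail` → `…TaylorCap` → `…TaylorClose`) never projects the
radius conjunct of the family hypothesis (it uses injectivity `.1`, separation `.2.1`, the bent-homogeneous presentation `.2.2.2.1` and goodness only),
and these sit in the SAME positions in `CompFamilyW`; so the proof RE-RUNS VERBATIM.  This file is that re-run for the frame-pinned declarations of
`…TaylorSplit`, `…TaylorPair`, `…TaylorLeaves`, `…TaylorRegular` (MECHANICALLY GENERATED: each declaration below is the original with `Frame ↦ FrameW`,
`CompFamily1 ↦ CompFamilyW`, `TaylorTwoBent1 ↦ TaylorTwoBentW` and the copied names suffixed `W`; every family-FREE declaration of the originals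
(`images`, `matchScore`, `moved`, `linMatch`, `rimCol`, `inBallFrozen`, `pairD`, `dropped`, `PairChord`, `WrecC1`, `KbandCert`, …) is USED, not copied).
Pieces: `FrameW`, `ScoreLeMatchedW` (PROVED `scoreLeMatched_bentW`), `MatchedTaylorW` (⟸ `PairChord`: `matchedTaylor_of_pairChordW`), `GradientSplitW`
(PROVED), `MatchedIsFrozenInBallW` (PROVED), `BeyondBallTailW`; seams `taylorTwoBentW_of_pieces`, `taylorTwoBentW_of_pairChord`, `taylorTwoBentW_of_leaves`,
`taylorTwoBentW_of_NT : KbandCert → BeyondBallTailW → TaylorTwoBentW`.  The tail half (`…TaylorKband` … `…TaylorClose` re-run, ending in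
`taylorTwoBentW_holds`) is file TW `…WindowTaylorTail`.  No sorry, no new axioms, no cite tokens.
-/

open scoped BigOperators Classical
open Summit.AtomisticToContinuum.Crystallization.Theorems.FrustratedLawDichotomyRangeCut (Sep)
open Summit.AtomisticToContinuum.Crystallization.Theorems.FrustratedLawDichotomyMotifLemmas
open Summit.AtomisticToContinuum.Crystallization.Theorems.FrustratedLawDichotomyAveragingCut
open Summit.AtomisticToContinuum.Crystallization.Theorems.FrustratedLawDichotomyAveragingRuleCap
open Summit.AtomisticToContinuum.Crystallization.Theorems.FrustratedLawDichotomyAveragingRuleTightFree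
open Summit.AtomisticToContinuum.Crystallization.Theorems.FrustratedLawDichotomyExemptAbsorptionRecord
open Summit.AtomisticToContinuum.Crystallization.Theorems.FrustratedLawDichotomySchurCut
open Literature.MathematicalPhysics.StatisticalMechanics (lennardJones lennardJones_nonpos)
open Summit.AtomisticToContinuum.Crystallization.Theorems.FrustratedLawDichotomyRuleToolkitGood
open Summit.AtomisticToContinuum.Crystallization.Theorems.FrustratedLawDichotomyStrainedPatchHomSplit
open Summit.AtomisticToContinuum.Crystallization.Theorems.FrustratedLawDichotomyStrainedPatchHomTermCalculus
open Summit.AtomisticToContinuum.Crystallization.Theorems.FrustratedLawDichotomyStrainedPatchChartFamilies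
open Summit.AtomisticToContinuum.Crystallization.Theorems.FrustratedLawDichotomyStrainedPatchChartFamiliesBent
open Summit.AtomisticToContinuum.Crystallization.Theorems.FrustratedLawDichotomyStrainedPatchChartFamiliesPinned
open Summit.AtomisticToContinuum.Crystallization.Theorems.FrustratedLawDichotomyStrainedPatchEnvelopeLaw
open Summit.AtomisticToContinuum.Crystallization.Theorems.FrustratedLawDichotomyStrainedPatchEnvelopeTaylor
open Summit.AtomisticToContinuum.Crystallization.Theorems.FrustratedLawDichotomyStrainedPatchTaylorSplit
open Summit.AtomisticToContinuum.Crystallization.Theorems.FrustratedLawDichotomyStrainedPatchTaylorPair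
open Summit.AtomisticToContinuum.Crystallization.Theorems.FrustratedLawDichotomyStrainedPatchTaylorChord
open Summit.AtomisticToContinuum.Crystallization.Theorems.FrustratedLawDichotomyStrainedPatchTaylorLeaves
open Summit.AtomisticToContinuum.Crystallization.Theorems.FrustratedLawDichotomyStrainedPatchTaylorRegular
open Summit.AtomisticToContinuum.Crystallization.Theorems.FrustratedLawDichotomyStrainedPatchRecutPairs
open Summit.AtomisticToContinuum.Crystallization.Theorems.FrustratedLawDichotomyStrainedPatchRecutKinematics
open Summit.AtomisticToContinuum.Crystallization.Theorems.FrustratedLawDichotomyStrainedPatchWindowFamilies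

namespace Summit.AtomisticToContinuum.Crystallization.Theorems.FrustratedLawDichotomyStrainedPatchWindowTaylorSplit

/-! ## W re-run of `…TaylorSplit` -/

/-- (W re-run of `Frame`.) The common frame of the five pieces: a separated admissible cluster charted (coarse `7/20`, any fine `t`) and `1/20`-finely charted by an instance of `𝓘₁⁺`. -/
def FrameW (P : (M : ℕ) → (Fin M → E3) → Fin M → (M₁ : ℕ) → (Fin M₁ → E3) → Fin M₁ → (Fin M → Fin M₁) → Prop) : Prop :=
  ∀ (M : ℕ) (z : Fin M → E3) (c : Fin M) (M₁ : ℕ) (z₁ : Fin M₁ → E3) (c₁ : Fin M₁) (e : Fin M → Fin M₁) (t : ℝ),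
    Admissible M z c → ChartBy CompFamilyW tau1 t z c z₁ c₁ e → FineChart delta0 z c z₁ c₁ e → P M z c M₁ z₁ c₁ e

/-- The W frame is the STRONGER one: a W piece gives the g53 piece (`ChartBy.mono_family compFamily1_le_W`). [formal bookkeeping] -/
theorem frame_of_frameW (P : (M : ℕ) → (Fin M → E3) → Fin M → (M₁ : ℕ) → (Fin M₁ → E3) → Fin M₁ → (Fin M → Fin M₁) → Prop) (h : FrameW P) :
    Frame P :=
  fun M z c M₁ z₁ c₁ e t hz hch hf => h M z c M₁ z₁ c₁ e t hz (hch.mono_family compFamily1_le_W) hf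

/-- (W re-run of `ScoreLeMatched`.) **(P1) `ScoreLeMatchedW`** — `S(z₁) ≤ F_S(z₁)`, `S = e(ball)`. PROVED below. -/
def ScoreLeMatchedW : Prop :=
  FrameW fun _ z c M₁ z₁ c₁ e => ballAvg (9 / 5) z₁ (xRec M₁ z₁) c₁ ≤ matchScore (images z c e) z₁ c₁ z₁

/-- (W re-run of `MatchedTaylor`.) **(P2a) `MatchedTaylorW`** [CALCULUS · C^{1,1} core · ATTACKABLE] — `F_S(z₁) + G_S·dev − quad_{w₀}(dev) ≤ F_S(moved)`. -/
def MatchedTaylorW : Prop :=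
  FrameW fun _ z c _ z₁ c₁ e => matchScore (images z c e) z₁ c₁ z₁ + linMatch z c z₁ c₁ e - quadTerm w0 z c z₁ c₁ e
    ≤ matchScore (images z c e) z₁ c₁ (moved z c z₁ c₁ e)

/-- (W re-run of `GradientSplit`.) **(P2b) `GradientSplitW`** — `lin_{G₀}(dev) ≤ G_S·dev + δ₀·rimCol(z₁)` (the dropped partners' gradient against `‖dev‖ ≤ δ₀`). PROVED below. -/
def GradientSplitW : Prop :=
  FrameW fun _ z c M₁ z₁ c₁ e => linTerm G0 z c z₁ c₁ e ≤ linMatch z c z₁ c₁ e + delta0 * rimCol M₁ z₁ c₁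

/-- (W re-run of `MatchedIsFrozenInBall`.) **(P3a) `MatchedIsFrozenInBallW`** — `F_S(moved) ≤ inBallFrozen` (in fact `=`: members ↔ images bijection, translations cancel). PROVED below. -/
def MatchedIsFrozenInBallW : Prop :=
  FrameW fun _ z c _ z₁ c₁ e => matchScore (images z c e) z₁ c₁ (moved z c z₁ c₁ e) ≤ inBallFrozen z c z₁ c₁ e

/-- (W re-run of `BeyondBallTail`.) **(P3b) `BeyondBallTailW`** [GEOMETRIC COUNTING · TRUE-type · ATTACKABLE] — `inBallFrozen ≤ frozenAvg + 10⁻⁵` (members' partners outside the chart ball: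
pair distance `∈ [4.45, 9/2)`, `|W| ≤ 7·10⁻⁸`, a `≈16°` cap per member `≥ 7/4` from the centre). -/
def BeyondBallTailW : Prop :=
  FrameW fun _ z c _ z₁ c₁ e => inBallFrozen z c z₁ c₁ e ≤ frozenAvg z c z₁ c₁ e + 1 / 100000

/-- (W re-run of `dist_gt_of_not_mem_images`.) A partner outside the image set lies beyond `119/20` from the instance centre (covering clause of the chart). [formal bookkeeping] -/
theorem dist_gt_of_not_mem_imagesW {t : ℝ} {M : ℕ} {z : Fin M → E3} {c : Fin M} {M₁ : ℕ} {z₁ : Fin M₁ → E3} {c₁ : Fin M₁} {e : Fin M → Fin M₁}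
    (hch : ChartBy CompFamilyW tau1 t z c z₁ c₁ e) {k : Fin M₁} (hk : k ∉ images z c e) : 119 / 20 < dist (z₁ k) (z₁ c₁) := by
  by_contra hle
  obtain ⟨a, ha, hak⟩ := hch.2.2.2.2.2 k (by rw [tau1]; linarith [not_lt.mp hle])
  exact hk (Finset.mem_image.2 ⟨a, mem_ball.2 ha, hak⟩)

/-- (W re-run of `xSm_le_matchSm`.) The smooth surplus of a member is at most its matched version: dropped partners have `W ≤ 0`. [folklore] -/
theorem xSm_le_matchSmW {t : ℝ} {M : ℕ} {z : Fin M → E3} {c : Fin M} {M₁ : ℕ} {z₁ : Fin M₁ → E3} {c₁ : Fin M₁} {e : Fin M → Fin M₁}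
    (hch : ChartBy CompFamilyW tau1 t z c z₁ c₁ e) {j : Fin M₁} (hj : j ∈ ball (9 / 5) z₁ c₁) : xSm M₁ z₁ j ≤ matchSm (images z c e) z₁ j := by
  have hsplit := Finset.sum_filter_add_sum_filter_not Finset.univ (fun k => k ∈ images z c e) (fun k => Wrec (dist (z₁ j) (z₁ k)))
  have hS : (Finset.univ.filter fun k => k ∈ images z c e) = images z c e := by ext k; simp
  have hneg : ∑ k ∈ Finset.univ.filter (fun k => k ∉ images z c e), Wrec (dist (z₁ j) (z₁ k)) ≤ 0 := by
    refine Finset.sum_nonpos fun k hk => ?_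
    have hk : k ∉ images z c e := (Finset.mem_filter.1 hk).2
    have hfar := dist_gt_of_not_mem_imagesW hch hk
    have hjc : dist (z₁ j) (z₁ c₁) ≤ 9 / 5 := mem_ball.1 hj
    have htri : dist (z₁ k) (z₁ c₁) ≤ dist (z₁ j) (z₁ k) + dist (z₁ j) (z₁ c₁) := by
      rw [dist_comm (z₁ j) (z₁ k)]; exact dist_triangle _ _ _
    exact Wrec_nonpos_of_three_le (by linarith)
  have hps : pairSumFeature Wrec M₁ z₁ j = ∑ k : Fin M₁, Wrec (dist (z₁ j) (z₁ k)) := rfl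
  simp only [xSm, matchSm, hps]
  rw [hS] at hsplit
  linarith

/-- (W re-run of `scoreLeMatched_bent1`.) ★ **(P1) PROVED**: `S(z₁) ≤ F_S(z₁)`. [folklore] -/
theorem scoreLeMatched_bentW : ScoreLeMatchedW := by
  intro M z c M₁ z₁ c₁ e t _ hch _
  unfold ballAvg matchScore
  refine Finset.sum_le_sum fun j hj => div_le_div_of_nonneg_right ?_ (card_ball_pos (by norm_num) z₁ j).le
  exact (xRec_le_xSm z₁ j).trans (xSm_le_matchSmW hch hj)

/-- (W re-run of `filter_fiber_eq`.) On the chart ball the fibre of `e` over `e a` is `{a}`. [formal bookkeeping] -/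
theorem filter_fiber_eqW {t : ℝ} {M : ℕ} {z : Fin M → E3} {c : Fin M} {M₁ : ℕ} {z₁ : Fin M₁ → E3} {c₁ : Fin M₁} {e : Fin M → Fin M₁}
    (hch : ChartBy CompFamilyW tau1 t z c z₁ c₁ e) {a : Fin M} (ha : a ∈ ball (63 / 10) z c) :
    (ball (63 / 10) z c).filter (fun a' => e a' = e a) = {a} := by
  ext a'
  simp only [Finset.mem_filter, Finset.mem_singleton]
  constructor
  · rintro ⟨ha', he⟩
    exact hch.2.2.2.2.1 a' a (mem_ball.1 ha') (mem_ball.1 ha) he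
  · rintro rfl
    exact ⟨ha, rfl⟩

/-- (W re-run of `moved_image`.) The displaced instance at an image: `moved (e a) = z a − z c + z₁ c₁`. [formal bookkeeping] -/
theorem moved_imageW {t : ℝ} {M : ℕ} {z : Fin M → E3} {c : Fin M} {M₁ : ℕ} {z₁ : Fin M₁ → E3} {c₁ : Fin M₁} {e : Fin M → Fin M₁}
    (hch : ChartBy CompFamilyW tau1 t z c z₁ c₁ e) {a : Fin M} (ha : a ∈ ball (63 / 10) z c) :
    moved z c z₁ c₁ e (e a) = z a - z c + z₁ c₁ := by
  simp only [moved, shiftField, filter_fiber_eqW hch ha, Finset.sum_singleton, dev]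
  abel

/-- (W re-run of `dist_moved_image`.) Pair distances between images of the displaced instance are the CLUSTER's pair distances. [formal bookkeeping] -/
theorem dist_moved_imageW {t : ℝ} {M : ℕ} {z : Fin M → E3} {c : Fin M} {M₁ : ℕ} {z₁ : Fin M₁ → E3} {c₁ : Fin M₁} {e : Fin M → Fin M₁}
    (hch : ChartBy CompFamilyW tau1 t z c z₁ c₁ e) {a a' : Fin M} (ha : a ∈ ball (63 / 10) z c) (ha' : a' ∈ ball (63 / 10) z c) :
    dist (moved z c z₁ c₁ e (e a)) (moved z c z₁ c₁ e (e a')) = dist (z a) (z a') := by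
  rw [moved_imageW hch ha, moved_imageW hch ha', dist_eq_norm, dist_eq_norm]
  congr 1
  abel

/-- (W re-run of `matchSm_moved_image`.) The matched surplus of an image of the displaced instance is the cluster site's in-ball surplus. [formal bookkeeping] -/
theorem matchSm_moved_imageW {t : ℝ} {M : ℕ} {z : Fin M → E3} {c : Fin M} {M₁ : ℕ} {z₁ : Fin M₁ → E3} {c₁ : Fin M₁} {e : Fin M → Fin M₁}
    (hch : ChartBy CompFamilyW tau1 t z c z₁ c₁ e) {a : Fin M} (ha : a ∈ ball (63 / 10) z c) :
    matchSm (images z c e) (moved z c z₁ c₁ e) (e a) = matchSm (ball (63 / 10) z c) z a := by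
  have hinj : Set.InjOn e (ball (63 / 10) z c : Finset (Fin M)) := fun b hb b' hb' h =>
    hch.2.2.2.2.1 b b' (mem_ball.1 (Finset.mem_coe.1 hb)) (mem_ball.1 (Finset.mem_coe.1 hb')) h
  simp only [matchSm, images]
  rw [Finset.sum_image hinj]
  congr 3
  exact Finset.sum_congr rfl fun a' ha' => by rw [dist_moved_imageW hch ha ha']

/-- (W re-run of `ball_eq_image_members`.) The members of the instance ball are exactly the images of the cluster sites charted into it. [formal bookkeeping] -/
theorem ball_eq_image_membersW {t : ℝ} {M : ℕ} {z : Fin M → E3} {c : Fin M} {M₁ : ℕ} {z₁ : Fin M₁ → E3} {c₁ : Fin M₁} {e : Fin M → Fin M₁}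
    (hch : ChartBy CompFamilyW tau1 t z c z₁ c₁ e) :
    ball (9 / 5) z₁ c₁ = ((ball (63 / 10) z c).filter (fun a => e a ∈ ball (9 / 5) z₁ c₁)).image e := by
  ext j
  simp only [Finset.mem_image, Finset.mem_filter]
  constructor
  · intro hj
    obtain ⟨a, ha, haj⟩ := hch.2.2.2.2.2 j (by rw [tau1]; linarith [mem_ball.1 hj])
    exact ⟨a, ⟨mem_ball.2 ha, haj ▸ hj⟩, haj⟩
  · rintro ⟨a, ⟨_, hmem⟩, rfl⟩
    exact hmem

/-- (W re-run of `matchedIsFrozenInBall_bent1`.) ★ **(P3a) PROVED**: `F_S(moved) ≤ inBallFrozen` (with equality). [folklore] -/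
theorem matchedIsFrozenInBall_bentW : MatchedIsFrozenInBallW := by
  intro M z c M₁ z₁ c₁ e t _ hch _
  apply le_of_eq
  have hinj : Set.InjOn e ((ball (63 / 10) z c).filter (fun a => e a ∈ ball (9 / 5) z₁ c₁) : Finset (Fin M)) := fun b hb b' hb' h =>
    hch.2.2.2.2.1 b b' (mem_ball.1 (Finset.mem_filter.1 (Finset.mem_coe.1 hb)).1) (mem_ball.1 (Finset.mem_filter.1 (Finset.mem_coe.1 hb')).1) h
  unfold matchScore inBallFrozen
  conv_lhs => rw [ball_eq_image_membersW hch]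
  rw [Finset.sum_image hinj]
  refine Finset.sum_congr rfl fun a ha => ?_
  rw [matchSm_moved_imageW hch (Finset.mem_filter.1 ha).1]

/-- (W re-run of `G0_eq_Gmatch_add`.) ★ The true gradient table splits: `G₀(b) = G_S(b) + droppedD(b)` at every image `b = e a`. [folklore] -/
theorem G0_eq_Gmatch_addW {t : ℝ} {M : ℕ} {z : Fin M → E3} {c : Fin M} {M₁ : ℕ} {z₁ : Fin M₁ → E3} {c₁ : Fin M₁} {e : Fin M → Fin M₁}
    (hch : ChartBy CompFamilyW tau1 t z c z₁ c₁ e) {a : Fin M} (ha : a ∈ ball (63 / 10) z c) :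
    G0 M₁ z₁ c₁ (e a) = Gmatch (images z c e) z₁ c₁ (e a) + droppedD (images z c e) z₁ c₁ (e a) := by
  have hsep : Sep z₁ := hch.1.2.1
  have hb : ∀ k ∈ outside (images z c e), k ≠ e a := fun k hk hke =>
    (Finset.mem_filter.1 hk).2 (Finset.mem_image.2 ⟨a, ha, hke.symm⟩)
  have hψ : DifferentiableAt ℝ (fun p : E3 => matchScore (images z c e) z₁ c₁ (Function.update z₁ (e a) p)) (z₁ (e a)) := by
    unfold matchScore matchSm
    refine DifferentiableAt.fun_sum fun j _ => differentiableAt_div_const ?_ _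
    refine DifferentiableAt.sub_const (differentiableAt_div_const (DifferentiableAt.sub_const ?_ _) _) _
    exact DifferentiableAt.fun_sum fun k _ => differentiableAt_pair_update hsep (e a) j k
  have hD := hasFDerivAt_dropped (S := images z c e) hsep c₁ hb
  have hfun : (fun p : E3 => froScore M₁ z₁ c₁ (Function.update z₁ (e a) p))
      = fun p => matchScore (images z c e) z₁ c₁ (Function.update z₁ (e a) p) + dropped (images z c e) z₁ c₁ (Function.update z₁ (e a) p) := by
    funext p
    exact froScore_eq_matchScore_add_dropped _ _ _ _
  show fderiv ℝ (fun p : E3 => froScore M₁ z₁ c₁ (Function.update z₁ (e a) p)) (z₁ (e a))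
    = fderiv ℝ (fun p : E3 => matchScore (images z c e) z₁ c₁ (Function.update z₁ (e a) p)) (z₁ (e a)) + droppedD (images z c e) z₁ c₁ (e a)
  rw [hfun]
  exact (hψ.hasFDerivAt.add hD).fderiv

/-- (W re-run of `gradientSplit_bent1`.) ★ **(P2b) PROVED**: `lin_{G₀}(dev) ≤ G_S·dev + δ₀·rimCol(z₁)`. [folklore] -/
theorem gradientSplit_bentW : GradientSplitW := by
  intro M z c M₁ z₁ c₁ e t _ hch hf
  have key : ∀ a ∈ ball (63 / 10) z c, G0 M₁ z₁ c₁ (e a) (dev z c z₁ c₁ e a) ≤ Gmatch (images z c e) z₁ c₁ (e a) (dev z c z₁ c₁ e a)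
      + (if e a ∈ ball (9 / 5) z₁ c₁ then (2 * ((ball (9 / 5) z₁ (e a)).card : ℝ))⁻¹
          * (∑ k ∈ outside (images z c e), |deriv Wrec (dist (z₁ (e a)) (z₁ k))|) * delta0 else 0) := by
    intro a ha
    rw [G0_eq_Gmatch_addW hch ha]
    refine add_le_add le_rfl ((droppedD_apply_le _ _ _ _ _).trans ?_)
    split_ifs with hm
    · exact mul_le_mul_of_nonneg_left (hf a (mem_ball.1 ha)) (by positivity)
    · exact le_rfl
  have hinj : Set.InjOn e ((ball (63 / 10) z c).filter (fun a => e a ∈ ball (9 / 5) z₁ c₁) : Finset (Fin M)) := fun b hb b' hb' h =>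
    hch.2.2.2.2.1 b b' (mem_ball.1 (Finset.mem_filter.1 (Finset.mem_coe.1 hb)).1) (mem_ball.1 (Finset.mem_filter.1 (Finset.mem_coe.1 hb')).1) h
  have hsub : outside (images z c e) ⊆ Finset.univ.filter (fun k => 119 / 20 < dist (z₁ k) (z₁ c₁)) := fun k hk =>
    Finset.mem_filter.2 ⟨Finset.mem_univ _, dist_gt_of_not_mem_imagesW hch (Finset.mem_filter.1 hk).2⟩
  have hcol : ∑ a ∈ ball (63 / 10) z c, (if e a ∈ ball (9 / 5) z₁ c₁ then (2 * ((ball (9 / 5) z₁ (e a)).card : ℝ))⁻¹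
      * (∑ k ∈ outside (images z c e), |deriv Wrec (dist (z₁ (e a)) (z₁ k))|) * delta0 else 0) ≤ delta0 * rimCol M₁ z₁ c₁ := by
    rw [Finset.sum_ite, Finset.sum_const_zero, add_zero, rimCol, Finset.mul_sum]
    conv_rhs => rw [ball_eq_image_membersW hch]
    rw [Finset.sum_image hinj]
    refine Finset.sum_le_sum fun a _ => ?_
    exact col_term_le (by positivity) (Finset.sum_le_sum_of_subset_of_nonneg hsub fun _ _ _ => abs_nonneg _) (by rw [delta0]; norm_num)
  calc linTerm G0 z c z₁ c₁ e ≤ ∑ a ∈ ball (63 / 10) z c, (Gmatch (images z c e) z₁ c₁ (e a) (dev z c z₁ c₁ e a)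
        + (if e a ∈ ball (9 / 5) z₁ c₁ then (2 * ((ball (9 / 5) z₁ (e a)).card : ℝ))⁻¹
          * (∑ k ∈ outside (images z c e), |deriv Wrec (dist (z₁ (e a)) (z₁ k))|) * delta0 else 0)) := Finset.sum_le_sum key
    _ = linMatch z c z₁ c₁ e + ∑ a ∈ ball (63 / 10) z c, (if e a ∈ ball (9 / 5) z₁ c₁ then (2 * ((ball (9 / 5) z₁ (e a)).card : ℝ))⁻¹
          * (∑ k ∈ outside (images z c e), |deriv Wrec (dist (z₁ (e a)) (z₁ k))|) * delta0 else 0) := by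
        rw [Finset.sum_add_distrib]; rfl
    _ ≤ linMatch z c z₁ c₁ e + delta0 * rimCol M₁ z₁ c₁ := add_le_add le_rfl hcol

/-- (W re-run of `taylorTwoBent1_of_pieces`.) ★★ THE (T2-bent₁) SEAM: (P2a) ∧ (P3b) ⟹ `TaylorTwoBentW` ((P1), (P2b), (P3a) are discharged by `scoreLeMatched_bentW`, `gradientSplit_bentW`,
`matchedIsFrozenInBall_bentW`). [folklore] -/
theorem taylorTwoBentW_of_pieces (h2a : MatchedTaylorW) (h3b : BeyondBallTailW) : TaylorTwoBentW := by
  intro M z c M₁ z₁ c₁ e t hz hch hf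
  have h1 := scoreLeMatched_bentW M z c M₁ z₁ c₁ e t hz hch hf
  have h₂ := h2a M z c M₁ z₁ c₁ e t hz hch hf
  have h₃ := gradientSplit_bentW M z c M₁ z₁ c₁ e t hz hch hf
  have h₄ := matchedIsFrozenInBall_bentW M z c M₁ z₁ c₁ e t hz hch hf
  have h₅ := h3b M z c M₁ z₁ c₁ e t hz hch hf
  rw [rho0_eq]
  linarith

/-! ## W re-run of `…TaylorPair` -/

/-- (W re-run of `shiftField_image`.) On images the transported deviation is the deviation: `shiftField (e a) = dev a`. [formal bookkeeping] -/
theorem shiftField_imageW {t : ℝ} {M : ℕ} {z : Fin M → E3} {c : Fin M} {M₁ : ℕ} {z₁ : Fin M₁ → E3} {c₁ : Fin M₁} {e : Fin M → Fin M₁}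
    (hch : ChartBy CompFamilyW tau1 t z c z₁ c₁ e) {a : Fin M} (ha : a ∈ ball (63 / 10) z c) :
    shiftField z c z₁ c₁ e (e a) = dev z c z₁ c₁ e a := by
  simp only [shiftField, filter_fiber_eqW hch ha, Finset.sum_singleton]

/-- (W re-run of `ball_subset_images`.) Members are images. [formal bookkeeping] -/
theorem ball_subset_imagesW {t : ℝ} {M : ℕ} {z : Fin M → E3} {c : Fin M} {M₁ : ℕ} {z₁ : Fin M₁ → E3} {c₁ : Fin M₁} {e : Fin M → Fin M₁}
    (hch : ChartBy CompFamilyW tau1 t z c z₁ c₁ e) : ball (9 / 5) z₁ c₁ ⊆ images z c e := by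
  rw [ball_eq_image_membersW hch]
  exact Finset.image_subset_image (Finset.filter_subset _ _)

/-- (W re-run of `linMatch_eq`.) ★ `lin_{G_S}(dev)` as the explicit pair sum `Σ_j Σ_{k ∈ S} (#B j)⁻¹·½·[j ≠ k]·D_{jk}(d_j − d_k)`. [formal bookkeeping] -/
theorem linMatch_eqW {t : ℝ} {M : ℕ} {z : Fin M → E3} {c : Fin M} {M₁ : ℕ} {z₁ : Fin M₁ → E3} {c₁ : Fin M₁} {e : Fin M → Fin M₁}
    (hch : ChartBy CompFamilyW tau1 t z c z₁ c₁ e) :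
    linMatch z c z₁ c₁ e = ∑ j ∈ ball (9 / 5) z₁ c₁, ∑ k ∈ images z c e, (((ball (9 / 5) z₁ j).card : ℝ))⁻¹ * (2⁻¹ *
      (if j = k then 0 else radD (z₁ j - z₁ k) (shiftField z c z₁ c₁ e j - shiftField z c z₁ c₁ e k))) := by
  have hsep : Sep z₁ := hch.1.2.1
  unfold linMatch
  rw [Finset.sum_congr rfl fun a _ => by rw [Gmatch_eq_Gexp hsep], sum_ball_eq_sum_images z c z₁ c₁ e (Gexp (images z c e) z₁ c₁)]
  simp only [Gexp, _root_.sum_apply, _root_.smul_apply, smul_eq_mul]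
  rw [Finset.sum_comm]
  refine Finset.sum_congr rfl fun j hj => ?_
  rw [← Finset.mul_sum, ← Finset.mul_sum, ← Finset.mul_sum, ← Finset.mul_sum, Finset.sum_comm]
  congr 2
  exact Finset.sum_congr rfl fun k hk => sum_Epair_apply z₁ (ball_subset_imagesW hch hj) hk _

/-- (W re-run of `quadTerm_eq`.) ★ `quad_{w₀}(dev)` as the explicit pair sum `Σ_j Σ_{k ∈ S} Kband(r_jk)/(4#B j)·‖d_j − d_k‖²`. [formal bookkeeping] -/
theorem quadTerm_eqW {t : ℝ} {M : ℕ} {z : Fin M → E3} {c : Fin M} {M₁ : ℕ} {z₁ : Fin M₁ → E3} {c₁ : Fin M₁} {e : Fin M → Fin M₁}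
    (hch : ChartBy CompFamilyW tau1 t z c z₁ c₁ e) :
    quadTerm w0 z c z₁ c₁ e = ∑ j ∈ ball (9 / 5) z₁ c₁, ∑ k ∈ images z c e,
      Kband (dist (z₁ j) (z₁ k)) / (4 * ((ball (9 / 5) z₁ j).card : ℝ)) * ‖shiftField z c z₁ c₁ e j - shiftField z c z₁ c₁ e k‖ ^ 2 := by
  have hinj : Set.InjOn e (ball (63 / 10) z c : Finset (Fin M)) := fun b hb b' hb' h =>
    hch.2.2.2.2.1 b b' (mem_ball.1 (Finset.mem_coe.1 hb)) (mem_ball.1 (Finset.mem_coe.1 hb')) h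
  have h1 : quadTerm w0 z c z₁ c₁ e = ∑ b ∈ images z c e, ∑ b' ∈ images z c e,
      w0 M₁ z₁ c₁ b b' * ‖shiftField z c z₁ c₁ e b - shiftField z c z₁ c₁ e b'‖ ^ 2 := by
    unfold quadTerm images
    rw [Finset.sum_image hinj]
    refine Finset.sum_congr rfl fun a ha => ?_
    rw [Finset.sum_image hinj]
    exact Finset.sum_congr rfl fun a' ha' => by rw [shiftField_imageW hch ha, shiftField_imageW hch ha']
  rw [h1]
  have h2 : ∀ b ∈ images z c e, ∑ b' ∈ images z c e, w0 M₁ z₁ c₁ b b' * ‖shiftField z c z₁ c₁ e b - shiftField z c z₁ c₁ e b'‖ ^ 2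
      = if b ∈ ball (9 / 5) z₁ c₁ then ∑ b' ∈ images z c e,
          Kband (dist (z₁ b) (z₁ b')) / (4 * ((ball (9 / 5) z₁ b).card : ℝ)) * ‖shiftField z c z₁ c₁ e b - shiftField z c z₁ c₁ e b'‖ ^ 2 else 0 := by
    intro b _
    split_ifs with hb
    · exact Finset.sum_congr rfl fun b' _ => by simp only [w0, if_pos hb]
    · exact Finset.sum_eq_zero fun b' _ => by simp only [w0, if_neg hb, zero_mul]
  rw [Finset.sum_congr rfl h2, Finset.sum_ite_mem, Finset.inter_eq_right.2 (ball_subset_imagesW hch)]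

/-- (W re-run of `matchedTaylor_of_pairChord`.) ★★ **(P2a) ⟸ (P2a-core)**: `MatchedTaylorW` from the pair chord lemma — sum the pair inequalities with weights `(#B j)⁻¹·½ ≥ 0`
(`‖p‖ ≥ 7/10` instance separation, `‖p+Δ‖ ≥ 7/10` cluster separation through `dist_moved_imageW`, `‖Δ‖ ≤ 2δ₀ = 1/10` fine chart). [folklore] -/
theorem matchedTaylor_of_pairChordW (hPC : PairChord) : MatchedTaylorW := by
  intro M z c M₁ z₁ c₁ e t hz hch hf
  have hsepz : Sep z := hz.2.1
  have hsep1 : Sep z₁ := hch.1.2.1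
  have hBS := ball_subset_imagesW hch
  -- the per-pair inequality, already weighted
  have pair : ∀ j ∈ ball (9 / 5) z₁ c₁, ∀ k ∈ images z c e,
      (((ball (9 / 5) z₁ j).card : ℝ))⁻¹ * (2⁻¹ * (if j = k then 0 else radD (z₁ j - z₁ k) (shiftField z c z₁ c₁ e j - shiftField z c z₁ c₁ e k)))
        - Kband (dist (z₁ j) (z₁ k)) / (4 * ((ball (9 / 5) z₁ j).card : ℝ)) * ‖shiftField z c z₁ c₁ e j - shiftField z c z₁ c₁ e k‖ ^ 2
      ≤ (((ball (9 / 5) z₁ j).card : ℝ))⁻¹ * (2⁻¹ * (Wrec (dist (moved z c z₁ c₁ e j) (moved z c z₁ c₁ e k)) - Wrec (dist (z₁ j) (z₁ k)))) := by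
    intro j hj k hk
    have hc : (0 : ℝ) ≤ (((ball (9 / 5) z₁ j).card : ℝ))⁻¹ * 2⁻¹ := by positivity
    have core : (if j = k then 0 else radD (z₁ j - z₁ k) (shiftField z c z₁ c₁ e j - shiftField z c z₁ c₁ e k))
        - Kband (dist (z₁ j) (z₁ k)) / 2 * ‖shiftField z c z₁ c₁ e j - shiftField z c z₁ c₁ e k‖ ^ 2
        ≤ Wrec (dist (moved z c z₁ c₁ e j) (moved z c z₁ c₁ e k)) - Wrec (dist (z₁ j) (z₁ k)) := by
      by_cases hjk : j = k
      · subst hjk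
        simp
      · rw [if_neg hjk]
        obtain ⟨a, ha, rfl⟩ := Finset.mem_image.1 (hBS hj)
        obtain ⟨a', ha', rfl⟩ := Finset.mem_image.1 hk
        have haa' : a ≠ a' := fun h => hjk (by rw [h])
        have h1 : 7 / 10 ≤ ‖z₁ (e a) - z₁ (e a')‖ := by rw [← dist_eq_norm]; exact hsep1 _ _ hjk
        have h2 : 7 / 10 ≤ ‖(z₁ (e a) - z₁ (e a')) + (shiftField z c z₁ c₁ e (e a) - shiftField z c z₁ c₁ e (e a'))‖ := by
          rw [← moved_sub_moved, ← dist_eq_norm, dist_moved_imageW hch ha ha']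
          exact hsepz a a' haa'
        have h3 : ‖shiftField z c z₁ c₁ e (e a) - shiftField z c z₁ c₁ e (e a')‖ ≤ 1 / 10 := by
          rw [shiftField_imageW hch ha, shiftField_imageW hch ha']
          have := hf a (mem_ball.1 ha)
          have := hf a' (mem_ball.1 ha')
          rw [delta0] at *
          linarith [norm_sub_le (dev z c z₁ c₁ e a) (dev z c z₁ c₁ e a')]
        have h := hPC _ _ h1 h2 h3
        simp only [radW] at h
        rw [← dist_eq_norm (z₁ (e a)) (z₁ (e a')), ← moved_sub_moved, ← dist_eq_norm (moved z c z₁ c₁ e (e a)) (moved z c z₁ c₁ e (e a'))] at h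
        linarith
    have h := mul_le_mul_of_nonneg_left core hc
    have e1 : (((ball (9 / 5) z₁ j).card : ℝ))⁻¹ * 2⁻¹ * ((if j = k then 0 else radD (z₁ j - z₁ k) (shiftField z c z₁ c₁ e j - shiftField z c z₁ c₁ e k))
        - Kband (dist (z₁ j) (z₁ k)) / 2 * ‖shiftField z c z₁ c₁ e j - shiftField z c z₁ c₁ e k‖ ^ 2)
        = (((ball (9 / 5) z₁ j).card : ℝ))⁻¹ * (2⁻¹ * (if j = k then 0 else radD (z₁ j - z₁ k) (shiftField z c z₁ c₁ e j - shiftField z c z₁ c₁ e k)))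
        - Kband (dist (z₁ j) (z₁ k)) / (4 * ((ball (9 / 5) z₁ j).card : ℝ)) * ‖shiftField z c z₁ c₁ e j - shiftField z c z₁ c₁ e k‖ ^ 2 := by
      ring
    rw [e1] at h
    linarith
  have hsum := Finset.sum_le_sum fun j hj => Finset.sum_le_sum fun k hk => pair j hj k hk
  simp only [Finset.sum_sub_distrib] at hsum
  rw [← linMatch_eqW hch, ← quadTerm_eqW hch, ← matchScore_sub] at hsum
  linarith

/-- (W re-run of `taylorTwoBent1_of_pairChord`.) ★★ (T2-bent₁) from the pair chord lemma and the beyond-ball tail: `PairChord → BeyondBallTailW → TaylorTwoBentW`. [folklore] -/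
theorem taylorTwoBentW_of_pairChord (h2 : PairChord) (h3b : BeyondBallTailW) : TaylorTwoBentW :=
  taylorTwoBentW_of_pieces (matchedTaylor_of_pairChordW h2) h3b

/-! ## W re-run of `…TaylorLeaves` -/

/-- (W re-run of `taylorTwoBent1_of_leaves`.) ★★ THE (T2-bent₁) SEAM AT LEAF LEVEL: (R) ∧ (N) ∧ (P3b) ⟹ `TaylorTwoBentW`. [folklore] -/
theorem taylorTwoBentW_of_leaves (hR : WrecC1) (hK : KbandCert) (h3b : BeyondBallTailW) : TaylorTwoBentW :=
  taylorTwoBentW_of_pairChord (pairChord_of_leaves hR hK) h3b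

/-! ## W re-run of `…TaylorRegular` -/

/-- (W re-run of `taylorTwoBent1_of_NT`.) ★★ THE (T2-bent₁) SEAM with (C) and (R) discharged: (N) ∧ (P3b) ⟹ `TaylorTwoBentW`. [folklore] -/
theorem taylorTwoBentW_of_NT (hK : KbandCert) (h3b : BeyondBallTailW) : TaylorTwoBentW := taylorTwoBentW_of_leaves wrecC1_holds hK h3b

end Summit.AtomisticToContinuum.Crystallization.Theorems.FrustratedLawDichotomyStrainedPatchWindowTaylorSplit
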